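/-
COR-CM (cell pub-hodgecm2, stage 2 of the Hodge ladder) — TRANSPOSITION day-1 assembly: VACUITY DISCIPLINE for the ∃-form socket
proposition `Universe.FaceThetaDataExists` (`B01/Transposition/Assembly.lean`, p271429 ✔, lead gen 6 / filed by tr-typer-6), per RULING
B01-R1 (b) «vacuity lemmas + shadow-falsity theorem per conjecture-def» and referee note ref-3 g32 (a) (HOME/INBOX l.3719).
AUTHORED (datum-level theorems, VERBATIM) by prover-pub-hodgecm2-b01-x1-0 — sketch `HOME/pub-hodgecm2-b01-x1/AssemblyNonVacuity-Sketch.lean`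
md5 bd68d9d2fc4f (HOME/INBOX l.3693); def-level restatements through `FaceThetaDataExists`, the binder-inhabitation lemma and the
`FaceThetaRealised → FaceThetaDataExists` comparison ADDED and the file FILED by prover-pub-hodgecm2-tr-typer-6-0 (path pre-ACKed by the lead,
HOME/INBOX l.3698 (3)).  Theorems only; nothing cited, nothing asserted.  FRAMING: HC_CM is NOT proved.
-/
import Summits.HodgeConjecture.CorCM.B01.Transposition.Assembly
import Summits.HodgeConjecture.CorCM.B01.ThetaRealisationSocketNonVacuity
import HarnessLib

/-!
# `FaceThetaDataExists` is falsifiable bookkeeping-free: it FAILS on the PerL shadow, and its binders are inhabited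

* `Universe.isEmpty_faceThetaDatum_perLShadow` — no face theta datum on the PerL shadow at ANY `(ι₁, V)` over a surface field of
  degree `∉ {24, 48}` (`lineField` + `Theta_sub` + `perLShadow_Uiso_eq_bot`).
* `Universe.not_faceThetaDataExists_perLShadow : ¬ U.perLShadow.FaceThetaDataExists` (witness `F = ℚ(ζ₇)`), and
  `not_forall_perL_imp_faceThetaDataExists : ¬ ∀ U, U.PerL → U.FaceThetaDataExists` (so the ∃-form, like the ∀-form
  `FaceThetaRealised`, is not a universe-uniform consequence of `PerL`; a discharge must use the model universe).
* `faceThetaDataExists_binders_inhabited` — the prefix `∀ F Galois, 6 ≤ [F:ℚ], ∀ f` ranges over a non-empty set.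
* `Universe.faceThetaDataExists_of_faceThetaRealised` — the ∀(ι₁,V) socket proposition implies the ∃-form (Landherr +
  `StubTree.admissible_exists`, tree theorems); the converse is not claimed.
-/

noncomputable section

open scoped TensorProduct
open NumberField

namespace Summit.HodgeConjecture.CorCM

open Literature.AlgebraicGeometry.Motives (CMType HodgeStructure)
open Literature.NumberTheory.Automorphic

namespace Universe

variable (U : Universe)

/-- **No face theta datum on the PerL shadow, at ANY `(ι₁, V)`**, over a surface field of degree `∉ {24, 48}`: a datum provides a theta
(12)-wedge with non-zero `L²`-image (`lineField`), but `Theta 0 Γ ⊆ U_{Ψ₀}(Γ) = ⊥` there (`perLShadow_Uiso_eq_bot`). [folklore] -/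
theorem isEmpty_faceThetaDatum_perLShadow {L : CMField} (hL : ¬ (Module.finrank ℚ L = 24 ∨ Module.finrank ℚ L = 48))
    (ι₁ : L →+* ℂ) (V : HermSpace3 L ι₁) (K : CMField) (Ψ : Fin 4 → CMType K) (σ : K →+* ℂ) :
    IsEmpty (U.perLShadow.FaceThetaDatum ι₁ V K Ψ σ) := by
  refine ⟨fun R => ?_⟩
  obtain ⟨Γ, ω₁, hω₁, ω₂, -, hv⟩ := R.lineField
  have h₁ : ω₁ = 0 := by
    have h : ω₁ ∈ U.perLShadow.Uiso Γ K (Ψ 0) σ := R.Theta_sub 0 Γ hω₁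
    rwa [U.perLShadow_Uiso_eq_bot hL ι₁ V Γ K (Ψ 0) σ, Submodule.mem_bot] at h
  exact hv (by rw [h₁, map_zero, LinearMap.zero_apply, map_zero])

/-- **The ∃-form socket proposition FAILS on the PerL shadow** (def-free body of `¬ U.perLShadow.FaceThetaDataExists`): at `F = ℚ(ζ₇)`
(Galois, degree `6 ∉ {24, 48}`, a face exists) no `(ι₁, V)` whatsoever carries a face theta datum. [folklore] -/
theorem not_exists_faceThetaDatum_perLShadow :
    ¬ ∀ (F : CMField), IsGalois ℚ F → 6 ≤ Module.finrank ℚ F → ∀ f : Face F,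
      ∃ ι₁ : F →+* ℂ, f.Admissible ι₁ ∧ ∃ V : HermSpace3 F ι₁, Nonempty (U.perLShadow.FaceThetaDatum ι₁ V F f.psi ι₁) := by
  intro h
  let F : CMField := ⟨CyclotomicField.{0} 7 ℚ⟩
  have hG : IsGalois ℚ F := isGalois_cyclotomicField_seven
  have h6 : Module.finrank ℚ F = 6 := UnitaryGroup.finrank_cyclotomicField_seven
  obtain ⟨f, -, -⟩ := exists_face_admissible F h6.ge
  obtain ⟨ι₁, -, V, ⟨R⟩⟩ := h F hG h6.ge f
  exact (U.isEmpty_faceThetaDatum_perLShadow (by omega) ι₁ V F f.psi ι₁).false R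

/-- Hence the ∃-form socket proposition is not a universe-uniform consequence of `PerL` (relative to M13 + M14: the shadow satisfies
`PerL`). [folklore] -/
theorem not_forall_perL_imp_exists_faceThetaDatum (hE : U.Fact_eigenLine) (hA : U.Fact_alphaLine) :
    ¬ ∀ U' : Universe, U'.PerL → ∀ (F : CMField), IsGalois ℚ F → 6 ≤ Module.finrank ℚ F → ∀ f : Face F,
      ∃ ι₁ : F →+* ℂ, f.Admissible ι₁ ∧ ∃ V : HermSpace3 F ι₁, Nonempty (U'.FaceThetaDatum ι₁ V F f.psi ι₁) :=
  fun h => U.not_exists_faceThetaDatum_perLShadow (h _ (U.perLShadow_perL hE hA))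

end Universe

/-- **Unconditionally**: `∀ U, U.PerL → (∃-form face theta data)` is false (PerL shadow of the CM-type universe). [folklore] -/
theorem not_forall_perL_imp_exists_faceThetaDatum :
    ¬ ∀ U : Universe, U.PerL → ∀ (F : CMField), IsGalois ℚ F → 6 ≤ Module.finrank ℚ F → ∀ f : Face F,
      ∃ ι₁ : F →+* ℂ, f.Admissible ι₁ ∧ ∃ V : HermSpace3 F ι₁, Nonempty (U.FaceThetaDatum ι₁ V F f.psi ι₁) :=
  cmTypeUniverse.not_forall_perL_imp_exists_faceThetaDatum cmTypeUniverse_fact_eigenLine cmTypeUniverse_fact_alphaLine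

namespace Universe

/-- **`FaceThetaDataExists` FAILS on the PerL shadow** of every universe (the def-level form of
`not_exists_faceThetaDatum_perLShadow`). [folklore] -/
theorem not_faceThetaDataExists_perLShadow (U : Universe) : ¬ U.perLShadow.FaceThetaDataExists :=
  U.not_exists_faceThetaDatum_perLShadow

/-- The ∃-form is not a universe-uniform consequence of `PerL` (relative to M13 + M14), def-level form. [folklore] -/
theorem not_forall_perL_imp_faceThetaDataExists' (U : Universe) (hE : U.Fact_eigenLine) (hA : U.Fact_alphaLine) :
    ¬ ∀ U' : Universe, U'.PerL → U'.FaceThetaDataExists :=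
  U.not_forall_perL_imp_exists_faceThetaDatum hE hA

/-- **The ∀(ι₁,V) socket proposition implies the ∃-form** (`FaceThetaRealised`, `B01/ThetaRealisationSocketNonVacuity.lean:40`;
one admissible `ι₁` per face by `StubTree.admissible_exists`, one hermitian space by Landherr `landherr_exists_proof`). [folklore] -/
theorem faceThetaDataExists_of_faceThetaRealised {U : Universe} (h : U.FaceThetaRealised) : U.FaceThetaDataExists :=
  faceThetaDataExists_of_forall StubTree.admissible_exists (fun F ι₁ => landherr_exists_proof F ι₁) h

end Universe

/-- **Unconditionally: `∀ U, U.PerL → U.FaceThetaDataExists` is false** (PerL shadow of the CM-type universe). [folklore] -/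
theorem not_forall_perL_imp_faceThetaDataExists : ¬ ∀ U : Universe, U.PerL → U.FaceThetaDataExists :=
  not_forall_perL_imp_exists_faceThetaDatum

/-- **The binders of `FaceThetaDataExists` are inhabited**: a Galois CM field of degree `≥ 6` with a rank-four face exists
(`ℚ(ζ₇)`, `exists_face_admissible`), so the displayed hypothesis is not vacuously true by an empty range. [folklore] -/
theorem faceThetaDataExists_binders_inhabited :
    ∃ (F : CMField) (_ : IsGalois ℚ F) (_ : 6 ≤ Module.finrank ℚ F), Nonempty (Face F) := by
  obtain ⟨F, hG, h6, f, -, -, -, -⟩ := periodThmF_binders_inhabited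
  exact ⟨F, hG, h6, ⟨f⟩⟩

end Summit.HodgeConjecture.CorCM

end
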